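import Mathlib
import Summits.Ventures.PercRepro2.HCov
import Summits.Ventures.PercRepro2.HCovSwap
import Summits.Ventures.PercRepro2.GcSkelRules
import Summits.Ventures.PercRepro2.GcSkelReductionT
import Summits.Ventures.PercRepro2.GcSkelReductionMin
import Summits.Ventures.PercRepro2.GcSkelReductionZ
import Summits.Ventures.PercRepro2.GcSkelShapeT
import Summits.Ventures.PercRepro2.GcSkelShapeZ
import Summits.Ventures.PercRepro2.GcSkelSwap
import Summits.Ventures.PercRepro2.GcSkelNorm
import Summits.Ventures.PercRepro2.GcHatConn
import Summits.Ventures.PercRepro2.GcSkelReductionHat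
import Summits.Ventures.PercRepro2.GcSkelShapeHat
import Summits.Ventures.PercRepro2.GcSkelNormHat
import Summits.Ventures.PercRepro2.GcInterior
import Summits.Ventures.PercRepro2.GcInteriorDo
import Summits.Ventures.PercRepro2.GcRational
import Summits.Ventures.PercRepro2.GcBundleConn
import Summits.Ventures.PercRepro2.GcBundle
import Summits.Ventures.PercRepro2.GcSkelReductionBundle

/-!
# The class of record with no root bundle: its shape, the root swap and the WLOG normalisations
(blind cell PercRepro2, typer-1 g57)

* **`shape_of_wredMinHAZB`** — the shape of the class of record in one statement: the shape of
  `WReducedMinHAZH` (`shape_of_wredMinHAZH`) and no root bundle — no mark-free vertex set whose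
  external terminals are the two roots and one further vertex is touched by three non-loop edges;
* a root bundle is a root bundle for the swapped roots (`isBundle_swap`, `hasBundle_swap`), so the
  class is symmetric in the roots (**`wredMinHAZB_swap`**), and the two normalisations of
  `GcSkelNorm.lean` apply to it: **`HCov_all_iff_HCovWRedMinHAZBo_int_all`** (`o ↔ a₂` in
  `G − {a₁, a₃}` without loss of generality) and **`HCov_all_iff_HCovWRedMinHAZBg_int_all`**
  (`0 ≤ gap` without loss of generality), both over `ℝ ↔ ℚ`.

Standard axioms.
-/

namespace Summit.Ventures.PercRepro2

open CovForm RECM SepPair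

namespace WRed

section Shape

variable {V : Type*} {E : Type*} [Fintype E] [DecidableEq E] [DecidableEq V]

/-- **THE SHAPE OF THE CLASS OF RECORD WITH NO ROOT BUNDLE, IN ONE STATEMENT**: the shape of the
class with no hat, and no root bundle. -/
theorem shape_of_wredMinHAZB {ends : E → Sym2 V} {o a₁ a₂ a₃ b : V}
    (h : WReducedMinHAZB ends o a₁ a₂ a₃ b)
    (h12 : a₁ ≠ a₂) (h13 : a₁ ≠ a₃) (h23 : a₂ ≠ a₃) (ho1 : o ≠ a₁) (ho2 : o ≠ a₂) (ho3 : o ≠ a₃)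
    (hob : o ≠ b) (hb1 : b ≠ a₁) (hb2 : b ≠ a₂) (hb3 : b ≠ a₃) :
    (Simple ends ∧
    (∀ y, Unmarked o a₁ a₂ a₃ b y → nonLoopDeg ends y = 0 ∨ 3 ≤ nonLoopDeg ends y) ∧
    (nonLoopDeg ends o ≠ 1 ∧ nonLoopDeg ends b ≠ 1 ∧ nonLoopDeg ends a₁ ≠ 1 ∧
      nonLoopDeg ends a₂ ≠ 1) ∧
    (¬ IsolatedMark.IsIsolated ends a₁ ∧ ¬ IsolatedMark.IsIsolated ends a₂ ∧
      ¬ IsolatedMark.IsIsolated ends o ∧ ¬ IsolatedMark.IsIsolated ends b) ∧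
    (∀ v x y : V, x ≠ v → y ≠ v → x ≠ a₃ → y ≠ a₃ → (∃ e, x ∈ ends e ∧ ¬ (ends e).IsDiag) →
      (∃ e, y ∈ ends e ∧ ¬ (ends e).IsDiag) → Conn ends (sepConfig ends {v}) x y) ∧
    MarksReach ends o a₁ a₂ a₃ b ∧
    (∀ (W : Set V) (u v : V), Block.IsBlock ends W u v → (∀ y ∈ W, Unmarked o a₁ a₂ a₃ b y) →
      ∀ y ∈ W, nonLoopDeg ends y = 0) ∧
    (∃ (e : E) (x : V), ends e = s(o, x) ∧ x ≠ o ∧ x ≠ a₁ ∧ x ≠ a₂ ∧ x ≠ b) ∧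
    (∃ (e : E) (x : V), ends e = s(o, x) ∧ x ≠ o ∧ x ≠ a₃ ∧ x ≠ b) ∧
    (∃ (e : E) (x : V), ends e = s(b, x) ∧ x ≠ b ∧ x ≠ a₁ ∧ x ≠ a₂ ∧ x ≠ o) ∧
    (∃ (e : E) (x : V), (ends e = s(o, x) ∨ ends e = s(b, x)) ∧ Unmarked o a₁ a₂ a₃ b x) ∧
    (∃ (e : E) (x : V), ends e = s(a₃, x) ∧ Unmarked o a₁ a₂ a₃ b x) ∧
    (∃ x y : V, x ≠ y ∧ Unmarked o a₁ a₂ a₃ b x ∧ Unmarked o a₁ a₂ a₃ b y ∧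
      (∃ e, x ∈ ends e ∧ ¬ (ends e).IsDiag) ∧ (∃ e, y ∈ ends e ∧ ¬ (ends e).IsDiag)) ∧
    (∀ e, ends e ≠ s(a₁, a₂) ∧ ends e ≠ s(a₁, a₃) ∧ ends e ≠ s(a₂, a₃))) ∧
    ¬ HasHat ends o a₁ a₂ a₃ b ∧
    (∀ u, Unmarked o a₁ a₂ a₃ b u → ∀ e₁ e₂, ends e₁ = s(u, a₁) → ends e₂ = s(u, a₂) →
      4 ≤ nonLoopDeg ends u) ∧
    ¬ Bundle.HasBundle ends o a₁ a₂ a₃ b :=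
  let hH := wredMinHAZH_of_wredMinHAZB h
  let s := shape_of_wredMinHAZH hH h12 h13 h23 ho1 ho2 ho3 hob hb1 hb2 hb3
  ⟨s.1, s.2.1, s.2.2, h.noBundle⟩

end Shape

section Swap

variable {V : Type*} {E : Type*}

/-- A root bundle is a root bundle for the swapped roots. -/
lemma isBundle_swap {ends : E → Sym2 V} {W : Set V} {a₁ a₂ v : V}
    (h : Bundle.IsBundle ends W a₁ a₂ v) : Bundle.IsBundle ends W a₂ a₁ v where
  a₁_notMem := h.a₂_notMem
  a₂_notMem := h.a₁_notMem
  v_notMem := h.v_notMem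
  ends_mem := fun e he x y hxy => by
    obtain ⟨hx, hy⟩ := h.ends_mem e he x y hxy
    exact ⟨by tauto, by tauto⟩

variable [Fintype E] [DecidableEq E] [DecidableEq V]

omit [Fintype E] [DecidableEq E] [DecidableEq V] in
/-- `HasBundle` is symmetric in the roots. -/
lemma hasBundle_swap {ends : E → Sym2 V} {o a₁ a₂ a₃ b : V}
    (h : Bundle.HasBundle ends o a₁ a₂ a₃ b) : Bundle.HasBundle ends o a₂ a₁ a₃ b := by
  obtain ⟨W, v, hW, hU, hv1, hv2, eA, eB, e₃, hAB, hA3, hB3, hA, hB, h3, hdA, hdB, hd3⟩ := h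
  exact ⟨W, v, isBundle_swap hW, fun y hy => unmarked_swap (hU y hy), hv2, hv1, eA, eB, e₃, hAB,
    hA3, hB3, hA, hB, h3, hdA, hdB, hd3⟩

omit [DecidableEq E] in
/-- **THE CLASS OF RECORD WITH NO ROOT BUNDLE IS SYMMETRIC IN THE ROOTS.** -/
theorem wredMinHAZB_swap {ends : E → Sym2 V} {o a₁ a₂ a₃ b : V}
    (h : WReducedMinHAZB ends o a₁ a₂ a₃ b) : WReducedMinHAZB ends o a₂ a₁ a₃ b where
  toWReducedMinHAZ := wredMinHAZ_swap h.toWReducedMinHAZ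
  noBundle := fun hh => h.noBundle (hasBundle_swap hh)

end Swap

section Closures

variable (R : Type*) [Field R] [LinearOrder R] [IsStrictOrderedRing R]

/-- **(HCOV) on the class of record with no root bundle at interior weights, `o ↔ a₂` in
`G − {a₁, a₃}`.** -/
def HCovWRedMinHAZBo_int_all : Prop :=
  ∀ (V E : Type) [Fintype V] [DecidableEq V] [Fintype E] [DecidableEq E]
    (ends : E → Sym2 V) (p : E → R), IsIntVec p →
    ∀ o a₁ a₂ a₃ b : V, a₁ ≠ a₂ → a₁ ≠ a₃ → a₂ ≠ a₃ → o ≠ a₁ → o ≠ a₂ → o ≠ a₃ → o ≠ b →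
      b ≠ a₁ → b ≠ a₂ → b ≠ a₃ → WReducedMinHAZB ends o a₁ a₂ a₃ b →
      Conn ends (sepConfig ends {a₁, a₃}) o a₂ → HCov p ends o a₁ a₂ a₃ b

/-- **(HCOV) on the class of record with no root bundle at interior weights, nonnegative
gap.** -/
def HCovWRedMinHAZBg_int_all : Prop :=
  ∀ (V E : Type) [Fintype V] [DecidableEq V] [Fintype E] [DecidableEq E]
    (ends : E → Sym2 V) (p : E → R), IsIntVec p →
    ∀ o a₁ a₂ a₃ b : V, a₁ ≠ a₂ → a₁ ≠ a₃ → a₂ ≠ a₃ → o ≠ a₁ → o ≠ a₂ → o ≠ a₃ → o ≠ b →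
      b ≠ a₁ → b ≠ a₂ → b ≠ a₃ → WReducedMinHAZB ends o a₁ a₂ a₃ b →
      0 ≤ gap p ends a₁ a₂ b → HCov p ends o a₁ a₂ a₃ b

end Closures

section Main

variable {R : Type*} [Field R] [LinearOrder R] [IsStrictOrderedRing R]

omit [IsStrictOrderedRing R] in
/-- The normalised closure gives the closure. -/
theorem HCovWRedMinHAZB_int_all_of_o (h : HCovWRedMinHAZBo_int_all R) :
    HCovWRedMinHAZB_int_all R := by
  intro V E _ _ _ _ ends p hp o a₁ a₂ a₃ b h12 h13 h23 ho1 ho2 ho3 hob hb1 hb2 hb3 hred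
  have hI : WReducedI ends o a₁ a₂ a₃ b :=
    (wredT_iff_wredMin.2 hred.toWReducedMin).toWReducedI
  rcases conn_sepConfig_pair_of_wredI hI h12 h13 h23 ho1 ho2 ho3 hob hb1 hb2 hb3 with hc | hc
  · exact (HCov_swap p ends o a₁ a₂ a₃ b).1
      (h V E ends p hp o a₂ a₁ a₃ b h12.symm h23 h13 ho2 ho1 ho3 hob hb2 hb1 hb3
        (wredMinHAZB_swap hred) hc)
  · exact h V E ends p hp o a₁ a₂ a₃ b h12 h13 h23 ho1 ho2 ho3 hob hb1 hb2 hb3 hred hc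

/-- **THE CRUX ON THE CLASS OF RECORD WITH NO ROOT BUNDLE, `o ↔ a₂` OFF `{a₁, a₃}` WITHOUT LOSS
OF GENERALITY.** -/
theorem HCov_all_iff_HCovWRedMinHAZBo_int_all : HCov_all R ↔ HCovWRedMinHAZBo_int_all R :=
  ⟨fun h V E _ _ _ _ ends p hp o a₁ a₂ a₃ b h12 h13 h23 ho1 ho2 ho3 hob hb1 hb2 hb3 _ _ =>
      h V E ends p hp.isProbVec o a₁ a₂ a₃ b h12 h13 h23 ho1 ho2 ho3 hob hb1 hb2 hb3,
    fun h => HCov_all_of_HCovWRedMinHAZB_int_all (HCovWRedMinHAZB_int_all_of_o h)⟩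

/-- The gap-normalised closure gives the closure. -/
theorem HCovWRedMinHAZB_int_all_of_g (h : HCovWRedMinHAZBg_int_all R) :
    HCovWRedMinHAZB_int_all R := by
  intro V E _ _ _ _ ends p hp o a₁ a₂ a₃ b h12 h13 h23 ho1 ho2 ho3 hob hb1 hb2 hb3 hred
  by_cases hg : 0 ≤ gap p ends a₁ a₂ b
  · exact h V E ends p hp o a₁ a₂ a₃ b h12 h13 h23 ho1 ho2 ho3 hob hb1 hb2 hb3 hred hg
  · have hg' : 0 ≤ gap p ends a₂ a₁ b := by
      rw [gap_swap]
      exact neg_nonneg.2 (le_of_lt (not_le.1 hg))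
    exact (HCov_swap p ends o a₁ a₂ a₃ b).1
      (h V E ends p hp o a₂ a₁ a₃ b h12.symm h23 h13 ho2 ho1 ho3 hob hb2 hb1 hb3
        (wredMinHAZB_swap hred) hg')

/-- **THE CRUX ON THE CLASS OF RECORD WITH NO ROOT BUNDLE AND A NONNEGATIVE LABELLING GAP.** -/
theorem HCov_all_iff_HCovWRedMinHAZBg_int_all : HCov_all R ↔ HCovWRedMinHAZBg_int_all R :=
  ⟨fun h V E _ _ _ _ ends p hp o a₁ a₂ a₃ b h12 h13 h23 ho1 ho2 ho3 hob hb1 hb2 hb3 _ _ =>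
      h V E ends p hp.isProbVec o a₁ a₂ a₃ b h12 h13 h23 ho1 ho2 ho3 hob hb1 hb2 hb3,
    fun h => HCov_all_of_HCovWRedMinHAZB_int_all (HCovWRedMinHAZB_int_all_of_g h)⟩

end Main

section Real

/-- The structural normalisation over the rationals, on the class of record with no root
bundle. -/
theorem HCov_all_real_iff_HCovWRedMinHAZBo_int_all_rat :
    HCov_all ℝ ↔ HCovWRedMinHAZBo_int_all ℚ :=
  HCov_all_real_iff_rat.trans (HCov_all_iff_HCovWRedMinHAZBo_int_all (R := ℚ))

/-- The gap normalisation over the rationals, on the class of record with no root bundle. -/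
theorem HCov_all_real_iff_HCovWRedMinHAZBg_int_all_rat :
    HCov_all ℝ ↔ HCovWRedMinHAZBg_int_all ℚ :=
  HCov_all_real_iff_rat.trans (HCov_all_iff_HCovWRedMinHAZBg_int_all (R := ℚ))

end Real

end WRed

end Summit.Ventures.PercRepro2
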